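/-
Copyright (c) 2026 the pub-hodgecm-mathlib formalisation cell (harness21).  Prover seat hodgecm-mathlib-K2E2-p12 (g7): Track B «K2-LIT», ENGINE E1,
h413 = stmt-HodgeConjecture-24833; line `K2_E1_TraceFormulaBeta`, 5Res campaign, amendment #3 G8 (`hsymm_τ`), road (R) «ADJOINT + GALOIS REALITY» file (R4) (K2E1-plan (g7)
(285) GO): THE ASSEMBLY — the Weyl symmetry `s(1 − z) = s(z)` of the Hecke symbol of a TRANSPOSE-INVARIANT test function on the `(χ, K′, ω)`-sections of a SELF-DUAL UNITARY `χ`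
at a `c_G`-stable level, from ★ (R2) (adjoint identity) and ★ (R3) (Galois reality).  NO intertwining operator, NO `hMne`, NO functional equation.
-/
import Summits.HodgeConjecture.HodgeConjecture.Theorems.K2E1ChiSymbolAdjointU2            -- ★ (R2) p861091 (this seat): `symbol_eq_conj_adjointSymbol`
import Summits.HodgeConjecture.HodgeConjecture.Theorems.K2E1ChiSymbolGaloisRealityU2      -- ★ (R3) p861121 (this seat): `symbol_conj_comp_galTwist`, `conj_comp_galTwist_mem_chiSectionSpace`
import Summits.HodgeConjecture.HodgeConjecture.Theorems.K2E1ArchTestFunctionSymbolU2      -- ★ P1 (K2-defs1): `flatSectionU_ne_zero`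
import HarnessLib

/-!
# K2·E1 — `K2E1ChiSymbolWeylSymmetryTransposeU2` (road (R), file (R4)): `hsymm_τ` WITHOUT INTERTWINING OPERATORS — FOR A SELF-DUAL UNITARY `χ`, A `c_G`-STABLE LEVEL `(K′, ω)`
# AND A TRANSPOSE-INVARIANT TEST FUNCTION `h` (`h(c_G(y)⁻¹) = h(y)`), THE HECKE SYMBOL ON `V(χ, K′, ω)` SATISFIES `s(1 − z) = s(z)`, HENCE `s(½ − it) = s(½ + it)`

Track B ∕ K2-LIT, crux h413 = `stmt-HodgeConjecture-24833`, route of record `HCCMUnconditional`; cell `hodgecm-mathlib`, squad K2, ENGINE E1 (5Res campaign, amendment #3 «general (U,τ)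
ladder», rung G8: the letter `hsymm_τ` consumed by ★ `chi_scattering_matrix_fe_level_cm_two` (`hsym`) and by K2-defs1's `exists_chi_convData_level_cm_two_symm`; dealer K2E1-plan (g7)
ruling (285): road (R) GO — the `hMne ⟸ FE` road is circular and dropped).  THEOREMS ONLY (no `def`, no `instance`, no notation, no named-fact hypothesis, no `sorry`; default heartbeats);
lane `--supports stmt-HodgeConjecture-24833 --as helper` (count-neutral).  CLOSES NO SOCKET.  Generic quasi-split `(F, E, c)`, `N = 2`, `c² = 1 ≠ c`.

THE MATHEMATICS ([MoeglinWaldspurger1995, II.1.8, IV.1.10]; [Bump1997, Prop. 2.1.5, §2.6, Thm. 4.6.3 (Gelfand)]; [GelbartRogawski1991, §3.1]).  Data: the Galois twist `c_G` (★ (hcG)),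
the Iwasawa letter `G = B·K_U` (★ at the CM pair), a Haar measure `ν_G` (right- and inversion-invariant) and a Haar measure `μ_K` of `K_U`; a SELF-DUAL (`χʷ = χ`) UNITARY `χ`; a level
`(K′, ω)` with `c_G(K′) ⊆ K′` and `conj ω(c_G k) = ω(k)` (letters `hK`, `hω` — unitary `K_∞`-characters and `c`-stable finite levels); a continuous `ψ₀ ∈ V = V(χ, K′, ω)`, `ψ₀ ≠ 0`;
`h ∈ C_c(G)` with the TRANSPOSE INVARIANCE **(T)** `h(c_G(y)⁻¹) = h(y)` (`c_G(y)⁻¹ = J⁻¹ yᵀ J` on `U(J)`; automatic for `h = h_∞ ⊗ 𝟙_U` with `h_∞` `K_∞`-central — Gelfand's trick ★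
`K2E1ArchTransposeKConjugateU2` — and `c(U) = U`); the symbol law `hR` of `h` on ALL of `V` (★ P1 `exists_entire_symbol_of_arch`) and the symbol law `hR†` of `h†(y) := conj h(y⁻¹)` at `ψ₀`
(★ P1 again: `h† = (conj ∘ h_∞ ∘ inv) ⊗ 𝟙_U` is `K_∞`-central).  THEN:
(1) ★ (R2) ADJOINT: `s(w) = conj s†(1 − w̄)` for all `w`.  (2) ★ (R3) REALITY applied to `(h†, ψ₀, s†)`: the symbol of `(h†)^θ = conj ∘ h† ∘ c_G` on `ψ₀^θ = conj ∘ ψ₀ ∘ c_G` is `conj s†(w̄)`; but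
`(h†)^θ(y) = h(c_G(y)⁻¹) = h(y)` by (T), and `ψ₀^θ ∈ V` (★ (R3) level clause) is `≠ 0`, so `hR` at `ψ₀^θ` gives `s(w) = conj s†(w̄)`.  (3) Hence **`s(1 − z) = conj s†(conj z) = s(z)`**.
No intertwining operator, no non-vanishing letter `hMne`, no functional equation: the `z ↦ 1 − z̄` flip is unitarity of `R` on the induced pairing, the `z ↦ z̄` flip is the Galois twist.
* §1 HEAD **`symbol_weyl_symm_of_transpose`** (`∀ z, s (1 − z) = s z`), **`symbol_hsymm_of_transpose`** (`∀ t, s(½ − it) = s(½ + it)`, K2E1-p11's (y1-c) ∕ K2-defs1's byte shape).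
HONEST LABEL: HC_CM is proved only modulo the 7 printed citations (2 remaining named inputs: hLiu418 = `stmt-HodgeConjecture-24832`, h413 = `stmt-HodgeConjecture-24833`) until rung 0
closes; this file asserts no named fact and closes no socket; count-neutral; letters: (hcG), `hBK`, `hK`∕`hω`, (T), `hR`, `hR†` — all ★-inhabited at `c`-stable levels for `K_∞`-central
`h_∞ ⊗ 𝟙_U` (the CM∕`h_∞ ⊗ 𝟙_U` print is the next file).

## References
* [MoeglinWaldspurger1995] C. Mœglin, J.-L. Waldspurger, *Spectral decomposition and Eisenstein series* (1995), II.1.8, IV.1.10.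
* [Bump1997] D. Bump, *Automorphic Forms and Representations* (1997), Prop. 2.1.5, §2.6, Thm. 4.6.3.
* [GelbartRogawski1991] S. Gelbart, J. Rogawski, *L-functions and Fourier–Jacobi coefficients for the unitary group U(3)*, Invent. Math. 105 (1991), §3.1.
-/

set_option autoImplicit false
set_option linter.dupNamespace false -- the mandated namespace repeats `HodgeConjecture.HodgeConjecture`

noncomputable section

open MeasureTheory MeasureTheory.Measure Set Filter Topology Function NumberField IsDedekindDomain
open scoped NNReal ENNReal ComplexConjugate MatrixGroups
open Literature.NumberTheory Literature.NumberTheory.Automorphic Literature.NumberTheory.Automorphic.UnitaryGroup AdelicGroupData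
open Literature.NumberTheory.GaloisRepresentations (HeckeCharacter)
open Summit.HodgeConjecture.HodgeConjecture.Cruxes.H413.K2E1BorelEisensteinU
open Summit.HodgeConjecture.HodgeConjecture.Cruxes.H413.K2E1CharacterEisensteinU2Defs
open Summit.HodgeConjecture.HodgeConjecture.Cruxes.H413.K2E1ChiSectionSpaceU2Defs
open Summit.HodgeConjecture.HodgeConjecture.Cruxes.H413.K2E1QuasiSplitGaloisTwistU2 (galTwist_galTwist)
open Summit.HodgeConjecture.HodgeConjecture.Cruxes.H413.K2E1ArchTestFunctionSymbolU2 (flatSectionU_ne_zero)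
open Summit.HodgeConjecture.HodgeConjecture.Cruxes.H413.K2E1ChiSymbolAdjointU2 (symbol_eq_conj_adjointSymbol)
open Summit.HodgeConjecture.HodgeConjecture.Cruxes.H413.K2E1ChiSymbolGaloisRealityU2 (symbol_conj_comp_galTwist conj_comp_galTwist_mem_chiSectionSpace)

namespace Summit.HodgeConjecture.HodgeConjecture.Cruxes.H413.K2E1ChiSymbolWeylSymmetryTransposeU2

variable {F E : Type} [Field F] [NumberField F] [Field E] [NumberField E] [Algebra F E] {c : E ≃ₐ[F] E}
  [MeasurableSpace (quasiSplit F E c 2).Adelic] [BorelSpace (quasiSplit F E c 2).Adelic]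

/-- **`hsymm_τ` WITHOUT INTERTWINING OPERATORS: `s(1 − z) = s(z)`** for the Hecke symbol `s` of a TRANSPOSE-INVARIANT `h ∈ C_c(G)` (`(T) h(c_G(y)⁻¹) = h(y)`) on `V(χ, K′, ω)`, `χ` SELF-DUAL UNITARY,
`(K′, ω)` `c_G`-stable (`hK`, `hω`), `ψ₀ ∈ V` continuous `≠ 0`, given the symbol laws `hR` (of `h` on `V`) and `hR†` (of `h† = conj ∘ h ∘ inv` at `ψ₀`).  Proof: ★ (R2) `s(w) = conj s†(1 − w̄)`;
★ (R3) on `(h†, ψ₀, s†)` with `(h†)^θ = h` by (T) and `ψ₀^θ ∈ V` non-zero gives `s(w) = conj s†(w̄)`; combine at `w = 1 − z` and `w = z`.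
[cite: MoeglinWaldspurger1995, II.1.8 and IV.1.10] [cite: Bump1997, Prop. 2.1.5 and Thm. 4.6.3] [cite: GelbartRogawski1991, §3.1] -/
theorem symbol_weyl_symm_of_transpose (hc : c * c = 1) (hc1 : c ≠ 1)
    {cG : (quasiSplit F E c 2).Adelic →* (quasiSplit F E c 2).Adelic}
    (hcG : ∀ g, adelicVal F E c 2 _ (cG g) = Matrix.GeneralLinearGroup.map (conjAdele F E c) (adelicVal F E c 2 _ g))
    (hBK : ∀ g : (quasiSplit F E c 2).Adelic, ∃ b ∈ borelAdelic F E c 2, ∃ k : (quasiSplit F E c 2).Adelic,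
      adelicVal F E c 2 ((StdForm.antidiagonal 2).over E) k ∈ standardMaximalCompactGL 2 E ∧ g = b * k)
    (νG : Measure (quasiSplit F E c 2).Adelic) [νG.IsHaarMeasure] [νG.IsMulRightInvariant] [νG.IsInvInvariant]
    (μK : Measure ↥(((standardMaximalCompactGL 2 E).comap (adelicVal F E c 2 ((StdForm.antidiagonal 2).over E)) : Subgroup (quasiSplit F E c 2).Adelic))) [μK.IsHaarMeasure]
    {χ : HeckeCharacter E} (hsd : reflectChar c χ = χ) (hχ : χ.IsUnitary)
    {K' : Subgroup (quasiSplit F E c 2).Adelic} {ω : ↥K' → ℂ}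
    (hK : ∀ k : ↥K', cG (k : (quasiSplit F E c 2).Adelic) ∈ K') (hω : ∀ k : ↥K', conj (ω ⟨cG (k : (quasiSplit F E c 2).Adelic), hK k⟩) = ω k)
    {ψ₀ : (quasiSplit F E c 2).Adelic → ℂ} (hψ₀V : ψ₀ ∈ chiSectionSpace χ K' ω) (hψ₀c : Continuous ψ₀) (hne : ψ₀ ≠ 0)
    {h : (quasiSplit F E c 2).Adelic → ℂ} (hh : Continuous h) (hhs : HasCompactSupport h) (hT : ∀ y, h (cG y⁻¹) = h y)
    {s sadj : ℂ → ℂ}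
    (hR : ∀ (z : ℂ), ∀ ψ ∈ chiSectionSpace χ K' ω, ∀ x : (quasiSplit F E c 2).Adelic, ∫ y, h y * flatSectionU ψ z (x * y) ∂νG = s z * flatSectionU ψ z x)
    (hRadj : ∀ (z : ℂ) (x : (quasiSplit F E c 2).Adelic), ∫ y, conj (h y⁻¹) * flatSectionU ψ₀ z (x * y) ∂νG = sadj z * flatSectionU ψ₀ z x)
    (z : ℂ) : s (1 - z) = s z := by
  -- (1) the adjoint identity ★ (R2)
  have hadj : ∀ w : ℂ, s w = conj (sadj (1 - conj w)) := fun w =>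
    symbol_eq_conj_adjointSymbol hc hc1 hBK νG μK hχ (isChiSection_of_mem hψ₀V) hψ₀c hne hh hhs (fun z x => hR z ψ₀ hψ₀V x) hRadj w
  -- (2) Galois reality ★ (R3) for `(h†, ψ₀, s†)`; `(h†)^θ = h` by (T)
  have hreal : ∀ (w : ℂ) (x : (quasiSplit F E c 2).Adelic),
      ∫ y, h y * flatSectionU (fun g => conj (ψ₀ (cG g))) w (x * y) ∂νG = conj (sadj (conj w)) * flatSectionU (fun g => conj (ψ₀ (cG g))) w x := fun w x => by
    have h3 := symbol_conj_comp_galTwist hc hcG νG (ψ₀ := ψ₀) (h := fun y => conj (h y⁻¹)) (s := sadj) hRadj w x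
    have e : ∀ y : (quasiSplit F E c 2).Adelic, conj ((fun y => conj (h y⁻¹)) (cG y)) = h y := fun y => by
      simp only [Complex.conj_conj, ← map_inv, hT]
    simp_rw [e] at h3
    exact h3
  -- `ψ₀^θ ∈ V` is non-zero, so `hR` at `ψ₀^θ` pins `s(w) = conj s†(w̄)`
  have hθV : (fun g => conj (ψ₀ (cG g))) ∈ chiSectionSpace χ K' ω := conj_comp_galTwist_mem_chiSectionSpace hc hcG hsd hχ hK hω hψ₀V
  obtain ⟨x₀, hx₀⟩ := Function.ne_iff.1 hne
  have hθx : (fun g => conj (ψ₀ (cG g))) (cG x₀) ≠ 0 := by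
    show conj (ψ₀ (cG (cG x₀))) ≠ 0
    rw [galTwist_galTwist hc hcG x₀]
    exact fun h0 => hx₀ (by simpa using congrArg conj h0)
  have hreal' : ∀ w : ℂ, s w = conj (sadj (conj w)) := fun w => by
    have h1 := hR w _ hθV (cG x₀)
    rw [hreal w (cG x₀)] at h1
    exact (mul_right_cancel₀ (flatSectionU_ne_zero hθx w) h1).symm
  -- (3) combine
  rw [hadj (1 - z), hreal' z, map_sub, map_one, sub_sub_cancel]

/-- **`hsymm_τ` IN THE AXIS FORM `∀ t, s(½ − it) = s(½ + it)`** (K2E1-p11's (y1-c) ∕ K2-defs1's byte shape) — §1 at `z = ½ + it`. [cite: MoeglinWaldspurger1995, IV.1.10] [cite: Bump1997, Thm. 4.6.3] -/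
theorem symbol_hsymm_of_transpose (hc : c * c = 1) (hc1 : c ≠ 1)
    {cG : (quasiSplit F E c 2).Adelic →* (quasiSplit F E c 2).Adelic}
    (hcG : ∀ g, adelicVal F E c 2 _ (cG g) = Matrix.GeneralLinearGroup.map (conjAdele F E c) (adelicVal F E c 2 _ g))
    (hBK : ∀ g : (quasiSplit F E c 2).Adelic, ∃ b ∈ borelAdelic F E c 2, ∃ k : (quasiSplit F E c 2).Adelic,
      adelicVal F E c 2 ((StdForm.antidiagonal 2).over E) k ∈ standardMaximalCompactGL 2 E ∧ g = b * k)
    (νG : Measure (quasiSplit F E c 2).Adelic) [νG.IsHaarMeasure] [νG.IsMulRightInvariant] [νG.IsInvInvariant]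
    (μK : Measure ↥(((standardMaximalCompactGL 2 E).comap (adelicVal F E c 2 ((StdForm.antidiagonal 2).over E)) : Subgroup (quasiSplit F E c 2).Adelic))) [μK.IsHaarMeasure]
    {χ : HeckeCharacter E} (hsd : reflectChar c χ = χ) (hχ : χ.IsUnitary)
    {K' : Subgroup (quasiSplit F E c 2).Adelic} {ω : ↥K' → ℂ}
    (hK : ∀ k : ↥K', cG (k : (quasiSplit F E c 2).Adelic) ∈ K') (hω : ∀ k : ↥K', conj (ω ⟨cG (k : (quasiSplit F E c 2).Adelic), hK k⟩) = ω k)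
    {ψ₀ : (quasiSplit F E c 2).Adelic → ℂ} (hψ₀V : ψ₀ ∈ chiSectionSpace χ K' ω) (hψ₀c : Continuous ψ₀) (hne : ψ₀ ≠ 0)
    {h : (quasiSplit F E c 2).Adelic → ℂ} (hh : Continuous h) (hhs : HasCompactSupport h) (hT : ∀ y, h (cG y⁻¹) = h y)
    {s sadj : ℂ → ℂ}
    (hR : ∀ (z : ℂ), ∀ ψ ∈ chiSectionSpace χ K' ω, ∀ x : (quasiSplit F E c 2).Adelic, ∫ y, h y * flatSectionU ψ z (x * y) ∂νG = s z * flatSectionU ψ z x)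
    (hRadj : ∀ (z : ℂ) (x : (quasiSplit F E c 2).Adelic), ∫ y, conj (h y⁻¹) * flatSectionU ψ₀ z (x * y) ∂νG = sadj z * flatSectionU ψ₀ z x)
    (t : ℝ) : s (1 / 2 - t * Complex.I) = s (1 / 2 + t * Complex.I) := by
  have h1 := symbol_weyl_symm_of_transpose hc hc1 hcG hBK νG μK hsd hχ hK hω hψ₀V hψ₀c hne hh hhs hT hR hRadj (1 / 2 + t * Complex.I)
  rw [← h1]
  congr 1
  ring

end Summit.HodgeConjecture.HodgeConjecture.Cruxes.H413.K2E1ChiSymbolWeylSymmetryTransposeU2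

end
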